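import Literature.Topology.FourManifolds.CappellShanesonHomotopySphere
import Literature.Topology.FourManifolds.CappellShanesonHomology
import Literature.Topology.FourManifolds.MappingTorusHomology
import Literature.Topology.FourManifolds.CappellShanesonSimplyConnected
import HarnessLib

/-!
# `H₂(T_A ∖ C) = 0` for a Cappell–Shaneson mapping torus: reduction to the homology of `T³`

Third file of the decomposition (D-0014 provefact, XL) of
`Literature.Topology.FourManifolds.nonempty_homotopyEquiv_sphere_four_of_isCappellShanesonSphere` (Cappell–Shaneson
spheres are homotopy 4-spheres; Cappell–Shaneson, *Some new four-manifolds*, Ann. of Math. 104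
(1976), §2). The `H₂` leaf of that fact was reduced in `CappellShanesonHomology.lean` to the named
fact `Literature.Topology.FourManifolds.isZero_singularHomology_two_mappingTorus_compl_sectionCircle` — `H₂(T_A ∖ C; ℤ) = 0` for
the mapping torus `T_A` of `A ∈ SL(3, ℤ)`, `det (A - 1) = ±1`, minus its section circle `C`. Here
that fact is **proved** from the Wang-sequence criterion of `MappingTorusHomology.lean` and two
textbook named facts about the 3-torus:

* `Literature.Topology.FourManifolds.singularHomology_threeTorus_linear`: `H₁(T³; ℤ) ≅ ℤ³` and `H₂(T³; ℤ) ≅ ℤ³` with the linear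
  torus map `torusMap A` acting by `A` and by `(A⁻¹)ᵀ = Λ²A` (Hatcher, *Algebraic Topology*,
  §3.C Exercise 11: the Pontryagin ring `H_*(Tⁿ; ℤ)` is the exterior algebra on `H₁`; Example 3.16);
* `Literature.Topology.FourManifolds.isIso_singularHomology_map_puncturedThreeTorusIncl`: `T³ ∖ {1} ↪ T³` induces isomorphisms
  on `H₁` and `H₂` (Hatcher Thm. 3.26, Lemma 3.27 and excision Thm. 2.20).

## The argument (`isZero_singularHomology_two_mappingTorus_compl_sectionCircle_of_facts`)

Removing the section circle `C = jA({1} × (0, 1)) ∪ jB({1} × (1/2, 3/2))` from the glued mapping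
torus `T = jA(T³ × (0, 1)) ∪ jB(T³ × (1/2, 3/2))` of `torusMap A` leaves the glued mapping torus of
`torusMap A` restricted to the punctured torus `T³ ∖ {1}` (`complMappingTorusDatum`; `1` is the
fixed point of every `torusMap A`). By the Wang criterion
(`MappingTorusDatum.isZero_singularHomology_two`, Hatcher Example 2.48, p. 151) it suffices that
`(torusMap A)|_* - 1` be injective on `H₁(T³ ∖ {1})` and surjective on `H₂(T³ ∖ {1})`; through the
two named facts these maps are `A - 1` and `(A⁻¹)ᵀ - 1` on `ℤ³`, invertible over `ℤ` exactly by the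
Cappell–Shaneson condition `det (A - 1) = ±1` (`det (A⁻¹ - 1) = -det (A - 1)`,
`Literature.Topology.FourManifolds.det_coe_inv_sub_one_fin_three`) (`mono_epi_map_torusMapPunctured`).

## Main statements

* `Literature.Topology.FourManifolds.IsMappingTorusOf.nonempty_mappingTorusDatum`, `Literature.Topology.FourManifolds.IsOpenGluingWith.mappingTorusDatum`
  (proved bridges: smooth mapping tori are models of `MappingTorusDatum`).
* `Literature.Topology.FourManifolds.torusMapPunctured`, `Literature.Topology.FourManifolds.complMappingTorusDatum` (proved): `T_A ∖ C` as a glued mapping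
  torus over `T³ ∖ {1}`.
* `Literature.Topology.FourManifolds.singularHomology_threeTorus_linear`, `Literature.Topology.FourManifolds.isIso_singularHomology_map_puncturedThreeTorusIncl`
  (**named facts**), `Literature.Topology.FourManifolds.exists_iso_singularHomology_puncturedThreeTorus` (proved consequence).
* `Literature.Topology.FourManifolds.mono_ofHom_mulVecLin_sub_id`, `Literature.Topology.FourManifolds.epi_ofHom_mulVecLin_sub_id`, `Literature.Topology.FourManifolds.mono_sub_id_of_conj`,
  `Literature.Topology.FourManifolds.epi_sub_id_of_conj`, `Literature.Topology.FourManifolds.mono_epi_map_torusMapPunctured` (proved linear algebra).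
* `Literature.Topology.FourManifolds.isZero_singularHomology_two_mappingTorus_compl_sectionCircle_of_facts` (proved): the named
  fact of `CappellShanesonHomology.lean` from Mayer–Vietoris (excision, `exact₁`, `exact₂`) and the
  two torus facts.
* `Literature.Topology.FourManifolds.isZero_singularHomologyZ_two_of_isCappellShanesonSphere_of_facts`,
  `Literature.Topology.FourManifolds.nonempty_homotopyEquiv_sphere_four_of_isCappellShanesonSphere_of_facts` and `…_of_facts'`
  (proved): the `H₂` leaf and the target fact of the whole decomposition from named facts only
  (simple connectivity, resp. its reduced form `CappellShaneson.normalClosure_pushOff_eq_top` of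
  `CappellShanesonSimplyConnected.lean`; the singular-homology facts; `spc4.S10`).

## References

* S. E. Cappell, J. L. Shaneson, *Some new four-manifolds*, Ann. of Math. 104 (1976) 61–72, §2
  [CappellShanesonAnnals1976].
* A. Hatcher, *Algebraic Topology* (2002), §2.2 Example 2.48 (p. 151), Thm. 2.20; §3.3 Thm. 3.26,
  Lemma 3.27; §3.C Exercise 11, Example 3.16 [HatcherAT2002].

## Design notes

* Everything is at universe `0` (the mapping tori of `IsCappellShanesonSphereOf` live in `Type`).
* The two named facts are stated for Mathlib's singular homology with `ℤ` coefficients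
  (`Literature.singularHomology ℤ ℤ`) and `ℤ³ = Fin 3 → ℤ`, with the actions as commuting squares in
  `ModuleCat ℤ`; only `SL(3, ℤ)` matrices are quantified over (what the Cappell–Shaneson family needs).
* No declaration in this file uses `sorry`.
-/

noncomputable section

open Set Function CategoryTheory Limits Topology
open scoped Manifold ContDiff Topology

namespace Literature.Topology.FourManifolds

/-- Local notation: `𝔼 n` is the model Euclidean space `EuclideanSpace ℝ (Fin n)`. -/
local notation "𝔼 " n:arg => EuclideanSpace ℝ (Fin n)

/-- Local notation: `𝕊 n` is the unit sphere in `EuclideanSpace ℝ (Fin (n + 1))`. -/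
local notation "𝕊 " n:arg => (Metric.sphere (0 : EuclideanSpace ℝ (Fin (n + 1))) 1)

/-- Local notation: the model with corners `𝓣 = (𝓡 1).prod ((𝓡 1).prod (𝓡 1))` of `ThreeTorus`. -/
local notation "𝓣" =>
  (ModelWithCorners.prod (𝓡 1) (ModelWithCorners.prod (𝓡 1) (𝓡 1)))

/-! ### The punctured 3-torus and its linear self-maps -/

section PuncturedTorus

/-- The **punctured 3-torus** `T³ ∖ {1}`: the 3-torus minus the common fixed point `1` of the
linear maps `torusMap A` (the fibre of `T_A ∖ C` over the base circle; Cappell–Shaneson 1976, §2).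
[folklore] -/
abbrev puncturedThreeTorus : Set ThreeTorus := {1}ᶜ

/-- The linear map `torusMap A`, `A ∈ SL(3, ℤ)`, restricted to the punctured torus `T³ ∖ {1}`
(it fixes `1` and is bijective). [folklore] -/
def torusMapPunctured (A : Matrix.SpecialLinearGroup (Fin 3) ℤ) :
    C(↥puncturedThreeTorus, ↥puncturedThreeTorus) where
  toFun x := ⟨torusDiffeomorph A x, fun h => x.2 (by
    have h' : torusDiffeomorph A x = torusDiffeomorph A 1 := by
      rw [torusDiffeomorph_apply_one]; exact h
    exact (torusDiffeomorph A).injective h')⟩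
  continuous_toFun := ((torusDiffeomorph A).continuous.comp continuous_subtype_val).subtype_mk _

/-- Values of `torusMapPunctured`. [folklore] -/
@[simp] theorem coe_torusMapPunctured_apply (A : Matrix.SpecialLinearGroup (Fin 3) ℤ)
    (x : ↥puncturedThreeTorus) : (torusMapPunctured A x : ThreeTorus) = torusMap A.1 x := rfl

end PuncturedTorus

/-! ### Smooth mapping tori carry the topological datum -/

section Bridge

variable {E H : Type*} [NormedAddCommGroup E] [NormedSpace ℝ E] [TopologicalSpace H]
  {I : ModelWithCorners ℝ E H}
  {ET HT : Type*} [NormedAddCommGroup ET] [NormedSpace ℝ ET] [TopologicalSpace HT]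
  {IT : ModelWithCorners ℝ ET HT}
  {M : Type*} [TopologicalSpace M] [ChartedSpace H M]
  {T : Type*} [TopologicalSpace T] [ChartedSpace HT T]

/-- A smooth mapping torus in the sense of `Literature.Topology.FourManifolds.IsMappingTorusOf` carries a `MappingTorusDatum`
(forget the smoothness of the gluing maps; the bridge suggested in the review of
`MappingTorusHomology.lean`), so that every smooth mapping torus is a model of the topological
datum. [folklore] -/
theorem IsMappingTorusOf.nonempty_mappingTorusDatum {φ : M ≃ₘ⟮I, I⟯ M}
    (h : IsMappingTorusOf IT T φ) : Nonempty (MappingTorusDatum ⇑φ T) := by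
  obtain ⟨jA, jB, hA, hAo, hB, hBo, hU, hR⟩ := h
  exact ⟨⟨jA, jB, hA.isEmbedding, hAo, hB.isEmbedding, hBo, hU, hR⟩⟩

/-- An explicit smooth open gluing along `mappingTorusRel φ` (`IsOpenGluingWith`) carries a
`MappingTorusDatum` with the same gluing maps. [folklore] -/
def IsOpenGluingWith.mappingTorusDatum {φ : M → M} {jA : M × ↥mappingTorusPieceOne → T}
    {jB : M × ↥mappingTorusPieceTwo → T}
    (h : IsOpenGluingWith (I.prod 𝓘(ℝ, ℝ)) (I.prod 𝓘(ℝ, ℝ)) IT (mappingTorusRel φ) jA jB) :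
    MappingTorusDatum φ T :=
  ⟨jA, jB, h.1.isEmbedding, h.2.1, h.2.2.1.isEmbedding, h.2.2.2.1, h.2.2.2.2.1, h.2.2.2.2.2⟩

end Bridge

/-! ### `T_A ∖ C` is a glued mapping torus of `torusMap A` on `T³ ∖ {1}` -/

section ComplementDatum

variable {A : Matrix.SpecialLinearGroup (Fin 3) ℤ} {T : Type} [TopologicalSpace T]
  [ChartedSpace (𝔼 4) T]
  {jA : ThreeTorus × ↥mappingTorusPieceOne → T} {jB : ThreeTorus × ↥mappingTorusPieceTwo → T}
  (hT : IsOpenGluingWith (ModelWithCorners.prod 𝓣 𝓘(ℝ, ℝ)) (ModelWithCorners.prod 𝓣 𝓘(ℝ, ℝ))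
    (𝓡 4) (mappingTorusRel ⇑(torusDiffeomorph A)) jA jB)
  {c : 𝕊 1 → T} (hrange : range c = jA '' ({1} ×ˢ univ) ∪ jB '' ({1} ×ˢ univ))

include hT hrange

/-- A point `jA (x, s)` of the mapping torus lies on the section circle iff `x = 1`. [folklore] -/
theorem jA_mem_range_sectionCircle_iff (x : ThreeTorus) (s : ↥mappingTorusPieceOne) :
    jA (x, s) ∈ range c ↔ x = 1 := by
  obtain ⟨hAe, -, hBe, -, -, hR⟩ := hT
  rw [hrange]
  constructor
  · rintro (⟨⟨x', s'⟩, ⟨hx', -⟩, h⟩ | ⟨⟨y, t⟩, ⟨hy, -⟩, h⟩)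
    · have hx1 : x' = 1 := hx'
      have hxx : x' = x := congrArg Prod.fst (hAe.isEmbedding.injective h)
      rw [← hxx]
      exact hx1
    · have hy1 : y = 1 := hy
      rcases (hR _ _).1 h.symm with ⟨-, h2⟩ | ⟨-, h2⟩
      · simp only at h2; rw [← h2]; exact hy1
      · simp only at h2
        rw [hy1] at h2
        have h3 : torusDiffeomorph A x = torusDiffeomorph A 1 := by
          rw [torusDiffeomorph_apply_one]; exact h2.symm
        exact (torusDiffeomorph A).injective h3
  · rintro rfl
    exact Or.inl ⟨(1, s), ⟨rfl, mem_univ _⟩, rfl⟩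

/-- A point `jB (y, t)` of the mapping torus lies on the section circle iff `y = 1`. [folklore] -/
theorem jB_mem_range_sectionCircle_iff (y : ThreeTorus) (t : ↥mappingTorusPieceTwo) :
    jB (y, t) ∈ range c ↔ y = 1 := by
  obtain ⟨hAe, -, hBe, -, -, hR⟩ := hT
  rw [hrange]
  constructor
  · rintro (⟨⟨x, s⟩, ⟨hx, -⟩, h⟩ | ⟨⟨y', t'⟩, ⟨hy', -⟩, h⟩)
    · have hx1 : x = 1 := hx
      rcases (hR _ _).1 h with ⟨-, h2⟩ | ⟨-, h2⟩
      · simp only at h2; rw [h2]; exact hx1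
      · simp only at h2; rw [h2, hx1]; exact torusDiffeomorph_apply_one A
    · have hy1 : y' = 1 := hy'
      have hyy : y' = y := congrArg Prod.fst (hBe.isEmbedding.injective h)
      rw [← hyy]
      exact hy1
  · rintro rfl
    exact Or.inr ⟨(1, t), ⟨rfl, mem_univ _⟩, rfl⟩

/-- The first cylinder of `T ∖ C`: `(T³ ∖ 1) × (0, 1) → T ∖ C`, `(x, s) ↦ jA (x, s)`. [folklore] -/
def complJA (a : ↥puncturedThreeTorus × ↥mappingTorusPieceOne) : ↥((range c)ᶜ : Set T) :=
  ⟨jA (a.1, a.2), fun h => a.1.2 ((jA_mem_range_sectionCircle_iff hT hrange _ _).1 h)⟩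

/-- The second cylinder of `T ∖ C`: `(T³ ∖ 1) × (1/2, 3/2) → T ∖ C`, `(y, t) ↦ jB (y, t)`.
[folklore] -/
def complJB (b : ↥puncturedThreeTorus × ↥mappingTorusPieceTwo) : ↥((range c)ᶜ : Set T) :=
  ⟨jB (b.1, b.2), fun h => b.1.2 ((jB_mem_range_sectionCircle_iff hT hrange _ _).1 h)⟩

/-- **`T_A ∖ C` is a glued mapping torus of `torusMap A` restricted to `T³ ∖ {1}`**: removing
the section circle `C = jA({1} × (0, 1)) ∪ jB({1} × (1/2, 3/2))` from the glued mapping torus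
`T = jA(T³ × (0, 1)) ∪ jB(T³ × (1/2, 3/2))` of `torusMap A` leaves the two cylinders over the
punctured torus, glued by the same relation (Cappell–Shaneson 1976, §2). [folklore] -/
def complMappingTorusDatum : MappingTorusDatum ⇑(torusMapPunctured A) ↥((range c)ᶜ : Set T) := by
  obtain ⟨hAe, hAo, hBe, hBo, hU, hR⟩ := id hT
  refine
    { jA := complJA hT hrange
      jB := complJB hT hrange
      hA := ?_
      hAo := ?_
      hB := ?_
      hBo := ?_
      hU := ?_
      hR := ?_ }
  · -- embedding: `jA ∘ (val × id)`, codomain-restricted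
    have h1 : IsEmbedding fun a : ↥puncturedThreeTorus × ↥mappingTorusPieceOne =>
        jA ((a.1 : ThreeTorus), a.2) :=
      hAe.isEmbedding.comp (IsEmbedding.subtypeVal.prodMap IsEmbedding.id)
    exact h1.codRestrict ((range c)ᶜ : Set T)
      fun a => (complJA hT hrange a).2
  · have h : range (complJA hT hrange) =
        Subtype.val ⁻¹' (jA '' ((puncturedThreeTorus : Set ThreeTorus) ×ˢ univ)) := by
      ext z
      constructor
      · rintro ⟨a, rfl⟩
        exact ⟨((a.1 : ThreeTorus), a.2), ⟨a.1.2, mem_univ _⟩, rfl⟩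
      · rintro ⟨⟨x, s⟩, ⟨hx, -⟩, hz⟩
        exact ⟨(⟨x, hx⟩, s), Subtype.ext hz⟩
    rw [h]
    exact ((⟨hAe.isEmbedding, hAo⟩ : IsOpenEmbedding jA).isOpenMap _
      ((isOpen_compl_singleton).prod isOpen_univ)).preimage continuous_subtype_val
  · have h1 : IsEmbedding fun b : ↥puncturedThreeTorus × ↥mappingTorusPieceTwo =>
        jB ((b.1 : ThreeTorus), b.2) :=
      hBe.isEmbedding.comp (IsEmbedding.subtypeVal.prodMap IsEmbedding.id)
    exact h1.codRestrict ((range c)ᶜ : Set T)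
      fun b => (complJB hT hrange b).2
  · have h : range (complJB hT hrange) =
        Subtype.val ⁻¹' (jB '' ((puncturedThreeTorus : Set ThreeTorus) ×ˢ univ)) := by
      ext z
      constructor
      · rintro ⟨b, rfl⟩
        exact ⟨((b.1 : ThreeTorus), b.2), ⟨b.1.2, mem_univ _⟩, rfl⟩
      · rintro ⟨⟨y, t⟩, ⟨hy, -⟩, hz⟩
        exact ⟨(⟨y, hy⟩, t), Subtype.ext hz⟩
    rw [h]
    exact ((⟨hBe.isEmbedding, hBo⟩ : IsOpenEmbedding jB).isOpenMap _
      ((isOpen_compl_singleton).prod isOpen_univ)).preimage continuous_subtype_val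
  · refine eq_univ_of_forall fun z => ?_
    have hz : (z : T) ∈ range jA ∪ range jB := by rw [hU]; exact mem_univ _
    rcases hz with ⟨⟨x, s⟩, hx⟩ | ⟨⟨y, t⟩, hy⟩
    · have hx1 : x ≠ 1 := fun h1 => z.2 (by
        rw [← hx, h1]; exact (jA_mem_range_sectionCircle_iff hT hrange 1 s).2 rfl)
      exact Or.inl ⟨(⟨x, hx1⟩, s), Subtype.ext hx⟩
    · have hy1 : y ≠ 1 := fun h1 => z.2 (by
        rw [← hy, h1]; exact (jB_mem_range_sectionCircle_iff hT hrange 1 t).2 rfl)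
      exact Or.inr ⟨(⟨y, hy1⟩, t), Subtype.ext hy⟩
  · rintro ⟨x, s⟩ ⟨y, t⟩
    change (⟨jA (x, s), _⟩ : ↥((range c)ᶜ : Set T)) = ⟨jB (y, t), _⟩ ↔ _
    rw [Subtype.mk.injEq, hR, mappingTorusRel, mappingTorusRel]
    simp only [coe_torusDiffeomorph]
    constructor
    · rintro (⟨h1, h2⟩ | ⟨h1, h2⟩)
      · exact Or.inl ⟨h1, Subtype.ext h2⟩
      · exact Or.inr ⟨h1, Subtype.ext h2⟩
    · rintro (⟨h1, h2⟩ | ⟨h1, h2⟩)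
      · exact Or.inl ⟨h1, congrArg Subtype.val h2⟩
      · exact Or.inr ⟨h1, congrArg Subtype.val h2⟩

end ComplementDatum

end Literature.Topology.FourManifolds

namespace Literature.Topology.FourManifolds

/-- Local notation: `𝔼 n` is the model Euclidean space `EuclideanSpace ℝ (Fin n)`. -/
local notation "𝔼 " n:arg => EuclideanSpace ℝ (Fin n)

/-- Local notation: `𝕊 n` is the unit sphere in `EuclideanSpace ℝ (Fin (n + 1))`. -/
local notation "𝕊 " n:arg => (Metric.sphere (0 : EuclideanSpace ℝ (Fin (n + 1))) 1)

/-- Local notation: the model with corners `𝓣 = (𝓡 1).prod ((𝓡 1).prod (𝓡 1))` of `ThreeTorus`. -/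
local notation "𝓣" =>
  (ModelWithCorners.prod (𝓡 1) (ModelWithCorners.prod (𝓡 1) (𝓡 1)))

/-! ### The homology of `T³` and of `T³ ∖ pt` with the `SL(3, ℤ)`-action (named facts) -/

section TorusHomology

/-- The linear torus map `torusMap A` as a continuous self-map of `T³`. [folklore] -/
def torusMapC (A : Matrix.SpecialLinearGroup (Fin 3) ℤ) : C(ThreeTorus, ThreeTorus) :=
  ⟨torusMap A.1, (contMDiff_torusMap A.1).continuous⟩

/-- The inclusion `T³ ∖ {1} ↪ T³`. [folklore] -/
def puncturedThreeTorusIncl : C(↥puncturedThreeTorus, ThreeTorus) :=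
  ⟨Subtype.val, continuous_subtype_val⟩

/-- The inclusion intertwines the restricted and the full linear torus map. [folklore] -/
theorem puncturedThreeTorusIncl_comp (A : Matrix.SpecialLinearGroup (Fin 3) ℤ) :
    puncturedThreeTorusIncl.comp (torusMapPunctured A) = (torusMapC A).comp puncturedThreeTorusIncl :=
  rfl

/-- **`H₁` and `H₂` of the 3-torus with their `SL(3, ℤ)`-action** (named fact, not proved here).
There are isomorphisms `H₁(T³; ℤ) ≅ ℤ³` and `H₂(T³; ℤ) ≅ ℤ³` under which, for every
`A ∈ SL(3, ℤ)`, the linear torus map `torusMap A` (`z ↦ (∏ⱼ zⱼ ^ A₀ⱼ, ∏ⱼ zⱼ ^ A₁ⱼ, ∏ⱼ zⱼ ^ A₂ⱼ)`)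
acts on coordinate vectors by `v ↦ A v` on `H₁` and by `v ↦ (A⁻¹)ᵀ v` on `H₂`. Source: the
Pontryagin ring `H_*(Tⁿ; ℤ)` is the exterior algebra `Λ_ℤ[x₁, …, xₙ]` on `H₁(Tⁿ) = ℤⁿ`
(Hatcher, *Algebraic Topology*, §3.C, Exercise 11; dually Example 3.16 for the cohomology ring),
naturally for the group endomorphism `torusMap A`, which is `A` on `H₁ = ℤ³` (the coordinate
circle `j` is sent to the loop `(z ^ A₀ⱼ, z ^ A₁ⱼ, z ^ A₂ⱼ)`, of class the `j`-th column of `A`)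
and hence `Λ²A` on `H₂ = Λ²ℤ³`; in the basis `x₂∧x₃, x₃∧x₁, x₁∧x₂` the matrix of `Λ²A` is the
cofactor matrix `det(A) · (A⁻¹)ᵀ = (A⁻¹)ᵀ`. Integer coefficients, Mathlib's singular homology
(`Literature.singularHomology ℤ ℤ`), `ℤ³ = Fin 3 → ℤ`. [cite: HatcherAT2002, §3.C Exercise 11 and Example 3.16] -/
def singularHomology_threeTorus_linear : Prop :=
  ∃ (β₁ : Literature.AlgebraicTopology.SingularHomology.singularHomology ℤ ℤ ThreeTorus 1 ≅ ModuleCat.of ℤ (Fin 3 → ℤ))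
    (β₂ : Literature.AlgebraicTopology.SingularHomology.singularHomology ℤ ℤ ThreeTorus 2 ≅ ModuleCat.of ℤ (Fin 3 → ℤ)),
    ∀ A : Matrix.SpecialLinearGroup (Fin 3) ℤ,
      Literature.AlgebraicTopology.SingularHomology.singularHomology.map ℤ ℤ (torusMapC A) 1 ≫ β₁.hom =
          β₁.hom ≫ ModuleCat.ofHom (Matrix.mulVecLin A.1) ∧
        Literature.AlgebraicTopology.SingularHomology.singularHomology.map ℤ ℤ (torusMapC A) 2 ≫ β₂.hom =
          β₂.hom ≫ ModuleCat.ofHom (Matrix.mulVecLin ((A⁻¹).1.transpose))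

/-- **Puncturing the 3-torus does not change `H₁` and `H₂`** (named fact, not proved here): the
inclusion `T³ ∖ {1} ↪ T³` induces isomorphisms on `H₁(−; ℤ)` and `H₂(−; ℤ)`. Mechanism: in the
exact sequence of the pair `(T³, T³ ∖ {1})`, `Hₖ(T³, T³ ∖ {1}) ≅ Hₖ(ℝ³, ℝ³ ∖ 0) ≅ H̃ₖ₋₁(S²)`
vanishes for `k ≠ 3` (excision, Hatcher Thm. 2.20, and the local homology groups `Hₖ(M | x)` of
§3.3), and `H₃(T³) → H₃(T³ | 1) ≅ ℤ` is onto for the closed connected orientable 3-manifold `T³`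
(Hatcher Thm. 3.26(a)), so `Hₖ(T³ ∖ {1}) → Hₖ(T³)` is an isomorphism for `k ≤ 2`. [cite: HatcherAT2002, §3.3 Thm. 3.26 and Lemma 3.27; §2.1 Thm. 2.20] -/
def isIso_singularHomology_map_puncturedThreeTorusIncl : Prop :=
  IsIso (Literature.AlgebraicTopology.SingularHomology.singularHomology.map ℤ ℤ puncturedThreeTorusIncl 1) ∧
    IsIso (Literature.AlgebraicTopology.SingularHomology.singularHomology.map ℤ ℤ puncturedThreeTorusIncl 2)

/-- **The action of `torusMap A` on `H₁`, `H₂` of the punctured torus** (from the two named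
facts): isomorphisms `Hₖ(T³ ∖ {1}; ℤ) ≅ ℤ³`, `k = 1, 2`, conjugating `(torusMap A)|_*` to `A` and
`(A⁻¹)ᵀ` respectively. [folklore] -/
theorem exists_iso_singularHomology_puncturedThreeTorus (h1 : singularHomology_threeTorus_linear)
    (h2 : isIso_singularHomology_map_puncturedThreeTorusIncl) :
    ∃ (β₁ : Literature.AlgebraicTopology.SingularHomology.singularHomology ℤ ℤ ↥puncturedThreeTorus 1 ≅ ModuleCat.of ℤ (Fin 3 → ℤ))
      (β₂ : Literature.AlgebraicTopology.SingularHomology.singularHomology ℤ ℤ ↥puncturedThreeTorus 2 ≅ ModuleCat.of ℤ (Fin 3 → ℤ)),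
      ∀ A : Matrix.SpecialLinearGroup (Fin 3) ℤ,
        Literature.AlgebraicTopology.SingularHomology.singularHomology.map ℤ ℤ (torusMapPunctured A) 1 ≫ β₁.hom =
            β₁.hom ≫ ModuleCat.ofHom (Matrix.mulVecLin A.1) ∧
          Literature.AlgebraicTopology.SingularHomology.singularHomology.map ℤ ℤ (torusMapPunctured A) 2 ≫ β₂.hom =
            β₂.hom ≫ ModuleCat.ofHom (Matrix.mulVecLin ((A⁻¹).1.transpose)) := by
  obtain ⟨β₁, β₂, hβ⟩ := h1
  obtain ⟨hι1, hι2⟩ := h2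
  refine ⟨asIso (Literature.AlgebraicTopology.SingularHomology.singularHomology.map ℤ ℤ puncturedThreeTorusIncl 1) ≪≫ β₁,
    asIso (Literature.AlgebraicTopology.SingularHomology.singularHomology.map ℤ ℤ puncturedThreeTorusIncl 2) ≪≫ β₂, fun A => ⟨?_, ?_⟩⟩
  · rw [Iso.trans_hom, asIso_hom, ← Category.assoc, ← Literature.AlgebraicTopology.SingularHomology.singularHomology.map_comp,
      puncturedThreeTorusIncl_comp, Literature.AlgebraicTopology.SingularHomology.singularHomology.map_comp, Category.assoc, (hβ A).1,
      Category.assoc]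
  · rw [Iso.trans_hom, asIso_hom, ← Category.assoc, ← Literature.AlgebraicTopology.SingularHomology.singularHomology.map_comp,
      puncturedThreeTorusIncl_comp, Literature.AlgebraicTopology.SingularHomology.singularHomology.map_comp, Category.assoc, (hβ A).2,
      Category.assoc]

/-- For an integer matrix `B` with `B - 1` invertible over `ℤ`, `v ↦ B v - v` is injective on
`ℤⁿ`: in `ModuleCat ℤ`, `B_* - 𝟙` is a monomorphism. [folklore] -/
theorem mono_ofHom_mulVecLin_sub_id (B : Matrix (Fin 3) (Fin 3) ℤ) (hB : IsUnit (B - 1)) :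
    Mono (ModuleCat.ofHom (Matrix.mulVecLin B) - 𝟙 (ModuleCat.of ℤ (Fin 3 → ℤ))) := by
  rw [ModuleCat.mono_iff_injective]
  have key : ∀ u : Fin 3 → ℤ,
      (ModuleCat.ofHom (Matrix.mulVecLin B) - 𝟙 (ModuleCat.of ℤ (Fin 3 → ℤ))).hom u =
        (B - 1).mulVec u := fun u => by
    rw [ModuleCat.hom_sub, ModuleCat.hom_id, ModuleCat.hom_ofHom, LinearMap.sub_apply,
      Matrix.mulVecLin_apply, LinearMap.id_apply, Matrix.sub_mulVec, Matrix.one_mulVec]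
  intro v w hvw
  change (ModuleCat.ofHom (Matrix.mulVecLin B) - 𝟙 (ModuleCat.of ℤ (Fin 3 → ℤ))).hom v =
    (ModuleCat.ofHom (Matrix.mulVecLin B) - 𝟙 (ModuleCat.of ℤ (Fin 3 → ℤ))).hom w at hvw
  rw [key, key] at hvw
  have h := congrArg ((B - 1)⁻¹.mulVec ·) hvw
  simp only [Matrix.mulVec_mulVec, Matrix.nonsing_inv_mul _ ((Matrix.isUnit_iff_isUnit_det _).1 hB),
    Matrix.one_mulVec] at h
  exact h

/-- For an integer matrix `B` with `B - 1` invertible over `ℤ`, `v ↦ B v - v` is surjective on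
`ℤⁿ`: in `ModuleCat ℤ`, `B_* - 𝟙` is an epimorphism. [folklore] -/
theorem epi_ofHom_mulVecLin_sub_id (B : Matrix (Fin 3) (Fin 3) ℤ) (hB : IsUnit (B - 1)) :
    Epi (ModuleCat.ofHom (Matrix.mulVecLin B) - 𝟙 (ModuleCat.of ℤ (Fin 3 → ℤ))) := by
  rw [ModuleCat.epi_iff_surjective]
  have key : ∀ u : Fin 3 → ℤ,
      (ModuleCat.ofHom (Matrix.mulVecLin B) - 𝟙 (ModuleCat.of ℤ (Fin 3 → ℤ))).hom u =
        (B - 1).mulVec u := fun u => by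
    rw [ModuleCat.hom_sub, ModuleCat.hom_id, ModuleCat.hom_ofHom, LinearMap.sub_apply,
      Matrix.mulVecLin_apply, LinearMap.id_apply, Matrix.sub_mulVec, Matrix.one_mulVec]
  intro w
  obtain ⟨v, hv⟩ := Matrix.mulVec_surjective_iff_isUnit.2 hB w
  exact ⟨v, by change (ModuleCat.ofHom (Matrix.mulVecLin B) - 𝟙 _).hom v = w; rw [key]; exact hv⟩

/-- `Mono`/`Epi` of `f_* - 𝟙` is invariant under conjugation by an isomorphism `β` with
`f_* ≫ β = β ≫ L`. [folklore] -/
theorem mono_sub_id_of_conj {C : Type*} [Category C] [Preadditive C] {X X' : C} (f : X ⟶ X)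
    (L : X' ⟶ X') (β : X ≅ X') (h : f ≫ β.hom = β.hom ≫ L) [Mono (L - 𝟙 X')] : Mono (f - 𝟙 X) := by
  have e : f - 𝟙 X = (β.hom ≫ (L - 𝟙 X')) ≫ β.inv := by
    rw [Preadditive.comp_sub, ← h, Preadditive.sub_comp, Category.assoc, Category.assoc,
      β.hom_inv_id, Category.comp_id, Category.id_comp, β.hom_inv_id]
  rw [e]
  infer_instance

/-- `Epi` version of `mono_sub_id_of_conj`. [folklore] -/
theorem epi_sub_id_of_conj {C : Type*} [Category C] [Preadditive C] {X X' : C} (f : X ⟶ X)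
    (L : X' ⟶ X') (β : X ≅ X') (h : f ≫ β.hom = β.hom ≫ L) [Epi (L - 𝟙 X')] : Epi (f - 𝟙 X) := by
  have e : f - 𝟙 X = (β.hom ≫ (L - 𝟙 X')) ≫ β.inv := by
    rw [Preadditive.comp_sub, ← h, Preadditive.sub_comp, Category.assoc, Category.assoc,
      β.hom_inv_id, Category.comp_id, Category.id_comp, β.hom_inv_id]
  rw [e]
  infer_instance

/-- **The Cappell–Shaneson condition at work.** If `det (A - 1) = ±1` then, granted the two named
facts on the homology of `T³` and `T³ ∖ pt`, `(torusMap A)|_* - 1` is injective on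
`H₁(T³ ∖ {1}; ℤ)` (since `A - 1` is invertible over `ℤ`) and surjective on `H₂(T³ ∖ {1}; ℤ)` (since
`(A⁻¹)ᵀ - 1 = (A⁻¹ - 1)ᵀ` is, `det (A⁻¹ - 1) = -det (A - 1)`; `Literature.Topology.FourManifolds.det_coe_inv_sub_one_fin_three`)
(Cappell–Shaneson 1976, §2). [cite: CappellShanesonAnnals1976, §2] -/
theorem mono_epi_map_torusMapPunctured (h1 : singularHomology_threeTorus_linear)
    (h2 : isIso_singularHomology_map_puncturedThreeTorusIncl)
    (A : Matrix.SpecialLinearGroup (Fin 3) ℤ) (hdet : (A.1 - 1).det = 1 ∨ (A.1 - 1).det = -1) :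
    Mono (Literature.AlgebraicTopology.SingularHomology.singularHomology.map ℤ ℤ (torusMapPunctured A) 1 - 𝟙 _) ∧
      Epi (Literature.AlgebraicTopology.SingularHomology.singularHomology.map ℤ ℤ (torusMapPunctured A) 2 - 𝟙 _) := by
  obtain ⟨β₁, β₂, hβ⟩ := exists_iso_singularHomology_puncturedThreeTorus h1 h2
  have hu1 : IsUnit (A.1 - 1) := isUnit_sub_one_of_det_sub_one A.1 hdet
  have hu2 : IsUnit ((A⁻¹).1.transpose - 1) := by
    rw [← Matrix.transpose_one, ← Matrix.transpose_sub, Matrix.isUnit_transpose]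
    apply isUnit_sub_one_of_det_sub_one
    rw [det_coe_inv_sub_one_fin_three]
    rcases hdet with h | h <;> simp [h]
  haveI := mono_ofHom_mulVecLin_sub_id _ hu1
  haveI := epi_ofHom_mulVecLin_sub_id _ hu2
  exact ⟨mono_sub_id_of_conj _ _ β₁ (hβ A).1, epi_sub_id_of_conj _ _ β₂ (hβ A).2⟩

end TorusHomology

/-! ### Assembly: `H₂(T_A ∖ C; ℤ) = 0` from the Wang criterion and the homology of `T³ ∖ pt` -/

section Assembly

/-- **`H₂(T_A ∖ C; ℤ) = 0` for a Cappell–Shaneson mapping torus, from textbook facts** (universe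
`0`): the named fact `Literature.Topology.FourManifolds.isZero_singularHomology_two_mappingTorus_compl_sectionCircle` of
`CappellShanesonHomology.lean` follows from (i) excision and Mayer–Vietoris exactness `exact₁`,
`exact₂` for singular homology (Hatcher Thm. 2.20, §2.2), (ii) the homology of `T³` with its
`SL(3, ℤ)`-action (`singularHomology_threeTorus_linear`, Hatcher §3.C Ex. 11) and (iii) the
puncture comparison (`isIso_singularHomology_map_puncturedThreeTorusIncl`, Hatcher Thm. 3.26):
`T_A ∖ C` is a glued mapping torus of `(torusMap A)|_{T³ ∖ 1}` (`complMappingTorusDatum`), whose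
`H₂` vanishes by the Wang criterion `MappingTorusDatum.isZero_singularHomology_two` since
`A_* - 1` is injective on `H₁` and `Λ²A_* - 1` surjective on `H₂` when `det (A - 1) = ±1`
(`mono_epi_map_torusMapPunctured`) (Cappell–Shaneson, Ann. of Math. 104 (1976), §2).
[cite: CappellShanesonAnnals1976, §2] -/
theorem isZero_singularHomology_two_mappingTorus_compl_sectionCircle_of_facts
    (hexc : ∀ (S : Type) [TopologicalSpace S],
      Literature.AlgebraicTopology.SingularHomology.relativeSingularHomology.isIso_map_of_interior_union_interior ℤ ℤ S)
    (h₁ : ∀ (S : Type) [TopologicalSpace S] (U V : Set S), Literature.AlgebraicTopology.SingularHomology.mayerVietoris.exact₁ ℤ ℤ U V)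
    (h₂ : ∀ (S : Type) [TopologicalSpace S] (U V : Set S), Literature.AlgebraicTopology.SingularHomology.mayerVietoris.exact₂ ℤ ℤ U V)
    (hT1 : singularHomology_threeTorus_linear)
    (hT2 : isIso_singularHomology_map_puncturedThreeTorusIncl) :
    isZero_singularHomology_two_mappingTorus_compl_sectionCircle := by
  intro A hdet T _ _ _ _ _ _ jA jB hT c hc hrange
  obtain ⟨hm, he⟩ := mono_epi_map_torusMapPunctured hT1 hT2 A hdet
  exact (complMappingTorusDatum hT hrange).isZero_singularHomology_two ℤ ℤ (hexc _) (hexc _)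
    (h₂ _ _ _) (h₁ _ _ _) (h₂ _ _ _)

end Assembly

end Literature.Topology.FourManifolds

/-! ### The `H₂` leaf and the target fact, assembled from textbook facts -/

namespace Literature.Topology.FourManifolds

universe u

/-- Local notation: `𝔼 n` is the model Euclidean space `EuclideanSpace ℝ (Fin n)`. -/
local notation "𝔼 " n:arg => EuclideanSpace ℝ (Fin n)

/-- **The `H₂` leaf from textbook facts** (universe `0`): the named fact
`isZero_singularHomologyZ_two_of_isCappellShanesonSphere` of `CappellShanesonHomotopySphere.lean`
for every `X : Type`, granted excision and Mayer–Vietoris exactness (`exact₁`, `exact₂`) for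
singular homology, the homology of spheres (Hatcher Thm. 2.20, §2.2, Cor. 2.14), the homology of
`T³` with its `SL(3, ℤ)`-action (Hatcher §3.C Ex. 11) and the puncture comparison (Hatcher Thm.
3.26) — all named facts, taken as hypotheses; everything else (the surgery Mayer–Vietoris
argument, the bundle projection, the Wang sequence, the linear algebra of `det (A - 1) = ±1`) is
proved (Cappell–Shaneson, Ann. of Math. 104 (1976), §2). [cite: CappellShanesonAnnals1976, §2] -/
theorem isZero_singularHomologyZ_two_of_isCappellShanesonSphere_of_facts
    (hexc : ∀ (S : Type) [TopologicalSpace S],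
      Literature.AlgebraicTopology.SingularHomology.relativeSingularHomology.isIso_map_of_interior_union_interior ℤ ℤ S)
    (h₁ : ∀ (S : Type) [TopologicalSpace S] (U V : Set S), Literature.AlgebraicTopology.SingularHomology.mayerVietoris.exact₁ ℤ ℤ U V)
    (h₂ : ∀ (S : Type) [TopologicalSpace S] (U V : Set S), Literature.AlgebraicTopology.SingularHomology.mayerVietoris.exact₂ ℤ ℤ U V)
    (hS : Literature.AlgebraicTopology.SingularHomology.isZero_singularHomology_sphere ℤ ℤ)
    (hT1 : singularHomology_threeTorus_linear)
    (hT2 : isIso_singularHomology_map_puncturedThreeTorusIncl)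
    (X : Type) [TopologicalSpace X] [ChartedSpace (𝔼 4) X] :
    isZero_singularHomologyZ_two_of_isCappellShanesonSphere X := fun h =>
  h.isZero_singularHomology_two_of_mayerVietoris hexc h₂ hS
    (isZero_singularHomology_two_mappingTorus_compl_sectionCircle_of_facts hexc h₁ h₂ hT1 hT2)

/-- **Cappell–Shaneson spheres are homotopy 4-spheres, from the remaining named facts** (every
universe): the target fact `nonempty_homotopyEquiv_sphere_four_of_isCappellShanesonSphere` follows
from (i) simple connectivity of Cappell–Shaneson spheres in `Type`
(`simplyConnectedSpace_of_isCappellShanesonSphere`, Cappell–Shaneson 1976 §2 — its group theory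
is proved in `CappellShanesonHomotopySphere.lean`), (ii) the singular-homology facts of
`isZero_singularHomologyZ_two_of_isCappellShanesonSphere_of_facts`, and (iii) the recognition of
homotopy 4-spheres `spc4.S10` (`nonempty_homotopyEquiv_sphere_four_iff`, Freedman–Quinn §10) at
universe `0`. [cite: CappellShanesonAnnals1976, §2] -/
theorem nonempty_homotopyEquiv_sphere_four_of_isCappellShanesonSphere_of_facts
    (hπ : ∀ (Y : Type) [TopologicalSpace Y] [ChartedSpace (𝔼 4) Y],
      simplyConnectedSpace_of_isCappellShanesonSphere Y)
    (hexc : ∀ (S : Type) [TopologicalSpace S],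
      Literature.AlgebraicTopology.SingularHomology.relativeSingularHomology.isIso_map_of_interior_union_interior ℤ ℤ S)
    (h₁ : ∀ (S : Type) [TopologicalSpace S] (U V : Set S), Literature.AlgebraicTopology.SingularHomology.mayerVietoris.exact₁ ℤ ℤ U V)
    (h₂ : ∀ (S : Type) [TopologicalSpace S] (U V : Set S), Literature.AlgebraicTopology.SingularHomology.mayerVietoris.exact₂ ℤ ℤ U V)
    (hS : Literature.AlgebraicTopology.SingularHomology.isZero_singularHomology_sphere ℤ ℤ)
    (hT1 : singularHomology_threeTorus_linear)
    (hT2 : isIso_singularHomology_map_puncturedThreeTorusIncl)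
    (hW : nonempty_homotopyEquiv_sphere_four_iff.{0})
    (X : Type u) [TopologicalSpace X] [ChartedSpace (𝔼 4) X] :
    nonempty_homotopyEquiv_sphere_four_of_isCappellShanesonSphere X :=
  nonempty_homotopyEquiv_sphere_four_of_isCappellShanesonSphere_of hπ
    (isZero_singularHomologyZ_two_of_isCappellShanesonSphere_of_facts hexc h₁ h₂ hS hT1 hT2) hW X

/-- **Cappell–Shaneson spheres are homotopy 4-spheres — the whole decomposition joined** (every
universe). The target fact from named facts only, with the simple-connectivity input taken in the
reduced form of the sibling decomposition `CappellShanesonSimplyConnected.lean`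
(`CappellShaneson.normalClosure_pushOff_eq_top`: `π₁(T ∖ c)` is normally generated by a push-off
of the section circle; Cappell–Shaneson 1976, §2), the singular-homology facts of
`isZero_singularHomologyZ_two_of_isCappellShanesonSphere_of_facts` (Hatcher Thm. 2.20, §2.2,
Cor. 2.14, §3.C Ex. 11, Thm. 3.26) and `spc4.S10` at universe `0` (Freedman–Quinn §10).
[cite: CappellShanesonAnnals1976, §2] -/
theorem nonempty_homotopyEquiv_sphere_four_of_isCappellShanesonSphere_of_facts'
    (hπ : CappellShaneson.normalClosure_pushOff_eq_top)
    (hexc : ∀ (S : Type) [TopologicalSpace S],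
      Literature.AlgebraicTopology.SingularHomology.relativeSingularHomology.isIso_map_of_interior_union_interior ℤ ℤ S)
    (h₁ : ∀ (S : Type) [TopologicalSpace S] (U V : Set S), Literature.AlgebraicTopology.SingularHomology.mayerVietoris.exact₁ ℤ ℤ U V)
    (h₂ : ∀ (S : Type) [TopologicalSpace S] (U V : Set S), Literature.AlgebraicTopology.SingularHomology.mayerVietoris.exact₂ ℤ ℤ U V)
    (hS : Literature.AlgebraicTopology.SingularHomology.isZero_singularHomology_sphere ℤ ℤ)
    (hT1 : singularHomology_threeTorus_linear)
    (hT2 : isIso_singularHomology_map_puncturedThreeTorusIncl)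
    (hW : nonempty_homotopyEquiv_sphere_four_iff.{0})
    (X : Type u) [TopologicalSpace X] [ChartedSpace (𝔼 4) X] :
    nonempty_homotopyEquiv_sphere_four_of_isCappellShanesonSphere X :=
  nonempty_homotopyEquiv_sphere_four_of_isCappellShanesonSphere_of_facts
    (fun Y _ _ => CappellShaneson.simplyConnectedSpace_of_isCappellShanesonSphere_of hπ Y)
    hexc h₁ h₂ hS hT1 hT2 hW X

end Literature.Topology.FourManifolds
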